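import Literature.MathematicalPhysics.QuantumFieldTheory.PlaquetteSystemTwistAgreement
import Literature.Probability.LatticeModels.AnchoredClusterExpansion
import HarnessLib

/-!
# Local (anchored) cluster sums of a plaquette–link system: `ln Z = Σ_p g(p)`, size truncation with tail `e^{-(R+1)}`,
# and locality of small anchored clusters

Topic `Literature/MathematicalPhysics/QuantumFieldTheory`; vocabulary of `PlaquetteSystemPolymers.lean` / `PlaquetteSystemPolymerExpansion.lean`
(`S : PlaquetteSystem P E G`, `S.polymerActivity`, `S.Z`, KP smallness from `#(S.nbrs p) ≤ Δ`) and of the abstract cluster-expansion layer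
`Literature.Probability.LatticeModels.{ClusterExpansion, ClusterExpansionKPBound, PolymerPressure, AnchoredClusterExpansion}` (`truncatedWeight`,
`clusterSupp`, `sum_powerset_powerset_eq_sum_sum_div`, `height_succ_le_card_of_reflTransGen`).  ONE DEFINITION (`PlaquetteSystem.localClusterSum`)
and theorems: the finite-volume free-energy bookkeeping of R. Kotecký, D. Preiss, CMP 103 (1986) 491 [KoteckyPreiss1986] p. 493 ("one may write down
a closed form expression for the bulk free energy and one has a good control of boundary terms") for the plaquette gas with the link-sharing
incompatibility `GeomInc S.linkRel` — the tree's `PolymerPressure.lean` does this for subset polymers of `ℤ^d` with `polyInc`; here the polymers are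
link-connected plaquette sets of an arbitrary finite incidence system (dw-p1 / planner ym-idea-4 RUNG-PLAN-K2 step K2-a for LINE g21-A `MagneticFluxCeiling`):

* `S.localClusterSum w R p = Σ_{C : p ∈ ⋃C, ‖C‖ ≤ R} Φ^T(C)/|⋃C|` — the anchored cluster sum truncated at total size `R`;
* `log_Z_eq_sum_localClusterSum` — `ln Z_w = Re Σ_p g_R(p)` for `R ≥` every total size (KP (2) + double counting over the support);
* `norm_sum_large_clusters_le`, `norm_localClusterSum_sub_le` — the families through `p` of total size `> R` weigh `≤ e^{-(R+1)}` (KP (4) at `{p}`);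
* `height_lt_of_truncatedWeight_ne_zero`, ★ `localClusterSum_eq_sum_ball` — for a height `ht` growing by at most one along `linkRel` and
  vanishing at `p`, every family through `p` with `Φ^T ≠ 0` is supported in `{ht < ‖C‖}`, so `g_R(p)` is a sum over families of subsets of the
  ball `{q : ht q < R}` (clusters are link-connected: supports of `GeomInc`-clusters of link-connected sets are link-connected).

HONEST FRAMING: finite-volume bookkeeping inside the Kotecký–Preiss region; no thermodynamic limit is taken here.  Consumed by the aspect
comparison `FinTorusAspectComparison.lean` (boxes `n₀×n₁×n₂×2n` vs `n₀×n₁×n₂×n`).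
-/

noncomputable section

open MeasureTheory Finset
open scoped BigOperators
open Literature.Probability.LatticeModels

namespace Literature.MathematicalPhysics.QuantumFieldTheory

namespace PlaquetteSystem

variable {P E G : Type*} (S : PlaquetteSystem P E G)

section Defs

variable [Fintype P] [DecidableEq P] [Fintype E] [DecidableEq E] [Group G] [TopologicalSpace G] [IsTopologicalGroup G]
  [CompactSpace G] [MeasurableSpace G] [BorelSpace G]

/-- **The anchored, size-truncated cluster sum at a plaquette**:
`g_R(p) = Σ_{C : p ∈ ⋃C, ‖C‖ ≤ R} Φ^T(C)/|⋃C|` over all finite families `C` of plaquette sets (`Φ^T` the Kotecký–Preiss truncated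
functional of the polymer activities of the family `w`; `‖C‖ = Σ_{X ∈ C} |X|`).  For `R ≥` the total size of every family this is the full
local free energy `g(p)` of [KP86] p. 493 (`log Ξ = Σ_p g(p)` by double counting); the truncation keeps the clusters that stay near `p`.
[cite: KoteckyPreiss1986, p. 493 (bulk free energy formula)] -/
def localClusterSum (w : P → G → ℝ) (R : ℕ) (p : P) : ℂ :=
  ∑ C ∈ (Finset.univ : Finset P).powerset.powerset with (p ∈ clusterSupp C ∧ ∑ X ∈ C, X.card ≤ R),
    truncatedWeight (GeomInc S.linkRel) (S.polymerActivity w) C / ((clusterSupp C).card : ℂ)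

end Defs

section LocalPressure

variable [Fintype P] [DecidableEq P] [Fintype E] [DecidableEq E] [Group G] [TopologicalSpace G] [IsTopologicalGroup G]
  [CompactSpace G] [MeasurableSpace G] [BorelSpace G]

/-- A family containing a non-polymer has vanishing truncated functional (its activity is `0`). [cite: KoteckyPreiss1986, §3 (11)] -/
theorem truncatedWeight_eq_zero_of_not_subset_polymers {w : P → G → ℝ} {C : Finset (Finset P)} (hC : ¬ C ⊆ S.polymers) :
    truncatedWeight (GeomInc S.linkRel) (S.polymerActivity w) C = 0 := by
  classical
  haveI : Std.Symm (GeomInc S.linkRel) := ⟨fun _ _ h => geomInc_symm _ S.linkRel_symm h⟩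
  obtain ⟨X, hXC, hX⟩ := Finset.not_subset.1 hC
  exact truncatedWeight_eq_zero_of_mem_of_eq_zero hXC
    (S.polymerActivity_of_not_isRConnected fun h => hX (S.mem_polymers.2 h))

/-- The cluster sum over families of polymers is the cluster sum over all families (plumbing). [cite: KoteckyPreiss1986, (2)] -/
theorem sum_powerset_polymers_eq_sum_univ (w : P → G → ℝ) (f : Finset (Finset P) → ℂ → ℂ) (hf : ∀ C, f C 0 = 0) :
    ∑ C ∈ S.polymers.powerset, f C (truncatedWeight (GeomInc S.linkRel) (S.polymerActivity w) C) =
      ∑ C ∈ (Finset.univ : Finset P).powerset.powerset, f C (truncatedWeight (GeomInc S.linkRel) (S.polymerActivity w) C) := by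
  classical
  rw [Finset.powerset_univ]
  refine (Finset.sum_subset (Finset.powerset_mono.2 (Finset.subset_univ _)) fun C _ hC => ?_)
  rw [Finset.mem_powerset] at hC
  rw [S.truncatedWeight_eq_zero_of_not_subset_polymers hC, hf]

/-- **`ln Z = Σ_p g(p)`**: inside the Kotecký–Preiss region the logarithm of the partition function of a family is the sum over
plaquettes of the anchored cluster sums with no truncation (`R` at least the total size of every family), [KP86] (2) plus double
counting over the support. [cite: KoteckyPreiss1986, p. 493 (bulk free energy formula)] -/
theorem log_Z_eq_sum_localClusterSum (hhol : ∀ p, Measurable fun U : E → G => S.hol U p) {Δ : ℕ}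
    (hΔ : ∀ p, (S.nbrs p).card ≤ Δ) {w : P → G → ℝ} (hw : ∀ p, Measurable (w p)) {ε : ℝ}
    (hε : ∀ p W, |w p W - 1| ≤ ε) (hsmall : ((Δ : ℝ) + 1) ^ 2 * (Real.exp 2 * ε) ≤ 1 / 2) {R : ℕ}
    (hR : ∀ C : Finset (Finset P), ∑ X ∈ C, X.card ≤ R) :
    Real.log (S.Z w) = (∑ p : P, S.localClusterSum w R p).re := by
  classical
  rw [S.log_Z_eq_re_polymerLogZ hhol hΔ hw hε hsmall, polymerLogZ_eq_sum_truncatedWeight]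
  congr 1
  rw [S.sum_powerset_polymers_eq_sum_univ w (fun _ z => z) (fun _ => rfl)]
  rw [sum_powerset_powerset_eq_sum_sum_div (Finset.univ : Finset P)
    (fun C => truncatedWeight (GeomInc S.linkRel) (S.polymerActivity w) C) ?_]
  · refine Finset.sum_congr rfl fun p _ => ?_
    unfold localClusterSum
    refine Finset.sum_congr (Finset.filter_congr fun C _ => ?_) fun C _ => rfl
    exact (and_iff_left (hR C)).symm
  · intro C _ hCe
    -- empty support: `C ⊆ {∅}`, and `∅` is not a polymer
    by_cases hC0 : C = ∅
    · rw [hC0]; exact truncatedWeight_empty _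
    · obtain ⟨X, hX⟩ := Finset.nonempty_iff_ne_empty.2 hC0
      have hXe : X = ∅ := by
        rw [← Finset.subset_empty, ← hCe]
        exact subset_clusterSupp hX
      haveI : Std.Symm (GeomInc S.linkRel) := ⟨fun _ _ h => geomInc_symm _ S.linkRel_symm h⟩
      refine truncatedWeight_eq_zero_of_mem_of_eq_zero hX ?_
      rw [hXe]
      exact S.polymerActivity_empty w

/-- **The tail of the anchored cluster sum**: the families through `p` of total size `> R` contribute at most `e^{-(R+1)}`
(Kotecký–Preiss estimate (4) at the one-plaquette polymer `{p}`, `a = d = |·|`). [cite: KoteckyPreiss1986, Theorem p. 492, estimate (4)] -/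
theorem norm_sum_large_clusters_le {Δ : ℕ} (hΔ : ∀ p, (S.nbrs p).card ≤ Δ) {w : P → G → ℝ} {ε : ℝ}
    (hε : ∀ p W, |w p W - 1| ≤ ε) (hsmall : ((Δ : ℝ) + 1) ^ 2 * (Real.exp 2 * ε) ≤ 1 / 2) (R : ℕ) (p : P) :
    ‖∑ C ∈ (Finset.univ : Finset P).powerset.powerset with (p ∈ clusterSupp C ∧ ¬ ∑ X ∈ C, X.card ≤ R),
        truncatedWeight (GeomInc S.linkRel) (S.polymerActivity w) C / ((clusterSupp C).card : ℂ)‖ ≤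
      Real.exp (-((R : ℝ) + 1)) := by
  classical
  haveI : Std.Refl (GeomInc S.linkRel) := ⟨geomInc_refl _⟩
  haveI : Std.Symm (GeomInc S.linkRel) := ⟨fun _ _ h => geomInc_symm _ S.linkRel_symm h⟩
  set 𝒞 := ((Finset.univ : Finset P).powerset.powerset.filter fun C => p ∈ clusterSupp C ∧ ¬ ∑ X ∈ C, X.card ≤ R)
    with h𝒞
  have hfact := koteckyPreiss_truncatedWeight_bound_holds (GeomInc S.linkRel) (S.polymerActivity w)
    (fun X : Finset P => (X.card : ℝ)) (fun X : Finset P => (X.card : ℝ))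
  have h1 := S.kp_hypothesis_polymerActivity_tsum hΔ hε hsmall
  have htouch : ∀ C ∈ 𝒞, KPTouches (GeomInc S.linkRel) C {p} := by
    intro C hC
    obtain ⟨-, hp, -⟩ := Finset.mem_filter.1 hC
    obtain ⟨X, hXC, hpX⟩ := mem_clusterSupp.1 hp
    exact ⟨X, hXC, Or.inr ⟨p, hpX, p, Finset.mem_singleton_self p, Or.inl rfl⟩⟩
  have hsize : ∀ C ∈ 𝒞, KPTouches (GeomInc S.linkRel) C {p} → ((R : ℝ) + 1) ≤ ∑ X ∈ C, ((X.card : ℕ) : ℝ) := by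
    intro C hC _
    obtain ⟨-, -, hbig⟩ := Finset.mem_filter.1 hC
    have : R + 1 ≤ ∑ X ∈ C, X.card := by omega
    exact_mod_cast this
  have hstep := sum_norm_truncatedWeight_le_exp_neg_of_touches hfact (fun _ => Nat.cast_nonneg _)
    (fun _ => Nat.cast_nonneg _) h1 𝒞 {p} (r := (R : ℝ) + 1) hsize
  have hfilter : 𝒞.filter (fun C => KPTouches (GeomInc S.linkRel) C {p}) = 𝒞 :=
    Finset.filter_true_of_mem htouch
  rw [hfilter] at hstep
  simp only [Finset.card_singleton, Nat.cast_one, mul_one] at hstep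
  refine (norm_sum_le _ _).trans ((Finset.sum_le_sum fun C hC => ?_).trans hstep)
  rw [norm_div]
  rcases Nat.eq_zero_or_pos (clusterSupp C).card with h0 | hpos
  · rw [h0]; simp
  · have h1le : (1 : ℝ) ≤ ‖((clusterSupp C).card : ℂ)‖ := by
      rw [Complex.norm_natCast]; exact_mod_cast hpos
    exact div_le_self (norm_nonneg _) h1le

/-- **The anchored cluster sum differs from its truncation at size `R` by at most `e^{-(R+1)}`.**
[cite: KoteckyPreiss1986, Theorem p. 492, estimate (4)] -/
theorem norm_localClusterSum_sub_le {Δ : ℕ} (hΔ : ∀ p, (S.nbrs p).card ≤ Δ) {w : P → G → ℝ} {ε : ℝ}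
    (hε : ∀ p W, |w p W - 1| ≤ ε) (hsmall : ((Δ : ℝ) + 1) ^ 2 * (Real.exp 2 * ε) ≤ 1 / 2) {R R' : ℕ}
    (hR' : ∀ C : Finset (Finset P), ∑ X ∈ C, X.card ≤ R') (p : P) :
    ‖S.localClusterSum w R' p - S.localClusterSum w R p‖ ≤ Real.exp (-((R : ℝ) + 1)) := by
  classical
  have hsplit : S.localClusterSum w R' p - S.localClusterSum w R p =
      ∑ C ∈ (Finset.univ : Finset P).powerset.powerset with (p ∈ clusterSupp C ∧ ¬ ∑ X ∈ C, X.card ≤ R),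
        truncatedWeight (GeomInc S.linkRel) (S.polymerActivity w) C / ((clusterSupp C).card : ℂ) := by
    unfold localClusterSum
    rw [sub_eq_iff_eq_add]
    have hfull : ((Finset.univ : Finset P).powerset.powerset.filter fun C => p ∈ clusterSupp C ∧ ∑ X ∈ C, X.card ≤ R') =
        ((Finset.univ : Finset P).powerset.powerset.filter fun C => p ∈ clusterSupp C) := by
      exact Finset.filter_congr fun C _ => and_iff_left (hR' C)
    rw [hfull, ← Finset.sum_filter_add_sum_filter_not
      ((Finset.univ : Finset P).powerset.powerset.filter fun C => p ∈ clusterSupp C) (fun C => ∑ X ∈ C, X.card ≤ R),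
      Finset.filter_filter, Finset.filter_filter, add_comm]
  rw [hsplit]
  exact S.norm_sum_large_clusters_le hΔ hε hsmall R p

/-! ### Locality: small anchored clusters stay near the anchor -/

omit [Fintype P] [Fintype E] [DecidableEq E] [Group G] [TopologicalSpace G] [IsTopologicalGroup G] [CompactSpace G]
  [MeasurableSpace G] [BorelSpace G] in
/-- **Supports of clusters of link-connected plaquette sets are link-connected** (the `GeomInc` twin of
`reflTransGen_clusterSupp_of_isPolymerCluster'`): any two plaquettes of `⋃ C` are joined by a `linkRel`-path inside `⋃ C`. [folklore] -/
private theorem reflTransGen_clusterSupp {C : Finset (Finset P)} (hCl : IsPolymerCluster (GeomInc S.linkRel) C)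
    (hconn : ∀ X ∈ C, IsRConnected S.linkRel X) {v u : P} (hv : v ∈ clusterSupp C) (hu : u ∈ clusterSupp C) :
    Relation.ReflTransGen (fun a b => S.linkRel a b ∧ a ∈ clusterSupp C ∧ b ∈ clusterSupp C) v u := by
  classical
  set Rch : P → Prop := fun x =>
    Relation.ReflTransGen (fun a b => S.linkRel a b ∧ a ∈ clusterSupp C ∧ b ∈ clusterSupp C) v x with hRch
  have hlift : ∀ X ∈ C, ∀ x ∈ X, ∀ x' ∈ X, Rch x → Rch x' := by
    intro X hX x hx x' hx' hRx
    have hXs : X ⊆ clusterSupp C := subset_clusterSupp hX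
    have hpath := (hconn X hX).2 x hx x' hx'
    have hmono := Relation.ReflTransGen.mono (r := fun a b => S.linkRel a b ∧ a ∈ X ∧ b ∈ X)
      (p := fun a b => S.linkRel a b ∧ a ∈ clusterSupp C ∧ b ∈ clusterSupp C)
      fun a b hab => ⟨hab.1, hXs hab.2.1, hXs hab.2.2⟩
    exact hRx.trans (hmono x x' hpath)
  by_contra hvu
  set C₁ : Finset (Finset P) := C.filter fun X => ∀ x ∈ X, Rch x with hC₁
  obtain ⟨X₀, hX₀, hvX₀⟩ := mem_clusterSupp.1 hv
  obtain ⟨X₁, hX₁, huX₁⟩ := mem_clusterSupp.1 hu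
  have hX₀C₁ : X₀ ∈ C₁ := Finset.mem_filter.2 ⟨hX₀, fun x hx => hlift X₀ hX₀ v hvX₀ x hx Relation.ReflTransGen.refl⟩
  have hX₁C₁ : X₁ ∉ C₁ := fun h1 => hvu ((Finset.mem_filter.1 h1).2 u huX₁)
  obtain ⟨γ₁, hγ₁, γ₂, hγ₂, hinc⟩ := hCl C₁ (Finset.filter_subset _ _) ⟨X₀, hX₀C₁⟩
    ⟨X₁, Finset.mem_sdiff.2 ⟨hX₁, hX₁C₁⟩⟩
  obtain ⟨hγ₂C, hγ₂C₁⟩ := Finset.mem_sdiff.1 hγ₂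
  have hγ₁R : ∀ x ∈ γ₁, Rch x := (Finset.mem_filter.1 hγ₁).2
  rcases hinc with hEq | ⟨a, ha, b, hb, hab⟩
  · exact hγ₂C₁ (hEq ▸ hγ₁)
  · have hRb : Rch b := by
      rcases hab with rfl | hR
      · exact hγ₁R a ha
      · exact (hγ₁R a ha).tail ⟨hR, subset_clusterSupp (Finset.mem_filter.1 hγ₁).1 ha, subset_clusterSupp hγ₂C hb⟩
    exact hγ₂C₁ (Finset.mem_filter.2 ⟨hγ₂C, fun x hx => hlift γ₂ hγ₂C b hb x hx hRb⟩)

/-- **Small anchored clusters stay near the anchor.**  Inside the Kotecký–Preiss region, let `ht` be a height on plaquettes growing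
by at most one along `linkRel` and vanishing at `p`.  If a family `C` through `p` has `Φ^T(C) ≠ 0`, then every plaquette of `⋃ C` has
height `< ‖C‖` (the family is a cluster of polymers, whose support is `linkRel`-connected; discrete intermediate values).
[cite: KoteckyPreiss1986, Theorem p. 492 (last assertion)] -/
theorem height_lt_of_truncatedWeight_ne_zero {Δ : ℕ} (hΔ : ∀ p, (S.nbrs p).card ≤ Δ) {w : P → G → ℝ} {ε : ℝ}
    (hε : ∀ p W, |w p W - 1| ≤ ε) (hsmall : ((Δ : ℝ) + 1) ^ 2 * (Real.exp 2 * ε) ≤ 1 / 2)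
    {ht : P → ℕ} (hlip : ∀ a b, S.linkRel a b → ht b ≤ ht a + 1) {C : Finset (Finset P)}
    (hC : truncatedWeight (GeomInc S.linkRel) (S.polymerActivity w) C ≠ 0) {p : P} (hp : p ∈ clusterSupp C) (hp0 : ht p = 0)
    {q : P} (hq : q ∈ clusterSupp C) : ht q < ∑ X ∈ C, X.card := by
  classical
  haveI : Std.Refl (GeomInc S.linkRel) := ⟨geomInc_refl _⟩
  haveI : Std.Symm (GeomInc S.linkRel) := ⟨fun _ _ h => geomInc_symm _ S.linkRel_symm h⟩
  -- `C` consists of polymers and is a cluster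
  have hCpol : C ⊆ S.polymers := by
    by_contra h
    exact hC (S.truncatedWeight_eq_zero_of_not_subset_polymers h)
  have hconn : ∀ X ∈ C, IsRConnected S.linkRel X := fun X hX => S.mem_polymers.1 (hCpol hX)
  have hCl : IsPolymerCluster (GeomInc S.linkRel) C := by
    by_contra hncl
    refine hC (truncatedWeight_eq_zero_of_not_isPolymerCluster (fun B hB t ht => ?_) hncl)
    have hKPt : IsKPVolume (GeomInc S.linkRel) (fun γ => (t : ℂ) * S.polymerActivity w γ)
        (fun X : Finset P => (X.card : ℝ)) C := fun γ hγ => by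
      refine le_trans (Finset.sum_le_sum fun γ' _ => ?_) (S.isKPVolume_polymerActivity hΔ hε hsmall C γ hγ)
      unfold kpTerm
      refine mul_le_mul_of_nonneg_right ?_ (Real.exp_nonneg _)
      rw [norm_mul, Complex.norm_real, Real.norm_eq_abs, abs_of_nonneg ht.1]
      exact mul_le_of_le_one_left (norm_nonneg _) ht.2
    exact polymerPartitionFunction_ne_zero_of_kp hKPt hB
  have hpath := S.reflTransGen_clusterSupp hCl hconn hp hq
  exact Nat.lt_of_succ_le ((height_succ_le_card_of_reflTransGen hlip hp hp0 hpath).trans (card_clusterSupp_le_sum_card C))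

/-- **The truncated anchored cluster sum only involves families supported in the ball `{ht < R}`**: with a height as above,
`g_R(p)` equals the same sum restricted to families of subsets of `{q : ht q < R}`. [cite: KoteckyPreiss1986, p. 493 (bulk free energy formula)] -/
theorem localClusterSum_eq_sum_ball {Δ : ℕ} (hΔ : ∀ p, (S.nbrs p).card ≤ Δ) {w : P → G → ℝ} {ε : ℝ}
    (hε : ∀ p W, |w p W - 1| ≤ ε) (hsmall : ((Δ : ℝ) + 1) ^ 2 * (Real.exp 2 * ε) ≤ 1 / 2)
    {ht : P → ℕ} (hlip : ∀ a b, S.linkRel a b → ht b ≤ ht a + 1) {p : P} (hp0 : ht p = 0) (R : ℕ) :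
    S.localClusterSum w R p =
      ∑ C ∈ ((Finset.univ : Finset P).filter fun q => ht q < R).powerset.powerset with
          (p ∈ clusterSupp C ∧ ∑ X ∈ C, X.card ≤ R),
        truncatedWeight (GeomInc S.linkRel) (S.polymerActivity w) C / ((clusterSupp C).card : ℂ) := by
  classical
  unfold localClusterSum
  symm
  refine Finset.sum_subset (fun C hC => ?_) fun C hC hCB => ?_
  · rw [Finset.mem_filter] at hC ⊢
    exact ⟨Finset.mem_powerset.2 fun X _ => Finset.mem_powerset.2 (Finset.subset_univ X), hC.2⟩
  · rw [Finset.mem_filter] at hC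
    obtain ⟨-, hp, hR⟩ := hC
    -- `C` is not inside the ball, so its truncated functional vanishes
    by_contra hne
    have hne' : truncatedWeight (GeomInc S.linkRel) (S.polymerActivity w) C ≠ 0 := fun h => hne (by rw [h, zero_div])
    refine hCB (Finset.mem_filter.2 ⟨?_, hp, hR⟩)
    rw [Finset.mem_powerset]
    intro X hX
    rw [Finset.mem_powerset]
    intro q hq
    rw [Finset.mem_filter]
    refine ⟨Finset.mem_univ _, lt_of_lt_of_le ?_ hR⟩
    exact S.height_lt_of_truncatedWeight_ne_zero hΔ hε hsmall hlip hne' hp hp0 (mem_clusterSupp.2 ⟨X, hX, hq⟩)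

end LocalPressure

end PlaquetteSystem

end Literature.MathematicalPhysics.QuantumFieldTheory

end
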